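import Summits.BirchSwinnertonDyer.BirchSwinnertonDyer.Theses.PrintX8VSC
import Summits.BirchSwinnertonDyer.BirchSwinnertonDyer.Theorems.PrintX8SharpFlatRankZeroRoadContra
import HarnessLib

/-!
# Route `PrintX8VSC` (print-keyed repair twin of `PrintX8VS`; born 2026-08-28T22:36Z), item stmt-BirchSwinnertonDyer-23744
# `RankZeroLinkOfPrintX8Contra` — PROVED by projection onto the print-keyed rank-zero road
# `X8MainConjectureRoadContra.missingPPartAt_rankZero_of_mainConjectureContra` (`Theorems/PrintX8SharpFlatRankZeroRoadContra.lean`)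

Cell `bsd-ssimc`, width seat `cruxlead-stmt-BirchSwinnertonDyer-19875-w3` (gen 10) under the 19875 LEAD (lane split on the host bus
2026-08-28T22:39Z–22:4xZ: w2 g11 = glue 23743; this seat = 23744 + 23746). HONEST FRAMING: plumbing over ONE piece of mathematics landed
in the sibling helper — Sprung 2024 §5.2 (Proof of Thm. 5.3: main conjecture ⟹ BSD_p at analytic rank 0) run for the PRINT-KEYED dual
`X^•(γ⁻¹)` through the `ι`-twist dictionary (`char X^•(γ) = ι(char X^•(γ⁻¹))`, `(ι gen)(0) = gen(0)`; Sprung 2024 Lemmas 5.5–5.9 are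
instantiated at key `γ` only, referee N-287b). The print-keyed main conjecture `SharpFlatMainConjectureX8Contra` (item 23742) is the
HYPOTHESIS; the conjuncts of `PublishedInputsX8Contra` used are `exists_isNewformOf`, `thm22_…`, `thm714_…`, `lem59AllN_…`, the period
unit at `3`, `hasEntireLFunction_rat` (`thm716_…_contra` is idle for this link). The main conjecture, leaf X8 and BSD are NOT proved here.

References: route file `Theses/PrintX8VSC.lean` (rev 2, items 23741 / 23742 / 23744); [Sprung2024] Thm. 5.3 (p. 38), §5.2 Lemmas 5.5–5.9
(pp. 39–41); [Sprung2012] Main Conj. 7.21 (p. 1505), §7.5; [GreenbergLNM1716] §1 (p. 60); [Miller2011LMS] Def. 1.1.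
-/

set_option autoImplicit false
-- justification: the mandated namespace `Summit.BirchSwinnertonDyer.BirchSwinnertonDyer.Theorems`
-- (single-conjunct summit, Sub = Summit) repeats a segment by design (D-0017).
set_option linter.dupNamespace false

namespace Summit.BirchSwinnertonDyer.BirchSwinnertonDyer.Theorems.PrintX8VSCGlue

open Literature
open Summit.BirchSwinnertonDyer.BirchSwinnertonDyer.Theses.PrintX8VSC

/-- **Item stmt-BirchSwinnertonDyer-23744 `PrintX8VSC.RankZeroLinkOfPrintX8Contra` holds**: published bundle → GZK → the print-keyed
♯/♭ main conjecture on X8 at analytic rank `≤ 1` → `Typed.MissingPPartAt W p` at every X8 pair of analytic rank `0` — the projection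
onto `X8MainConjectureRoadContra.missingPPartAt_rankZero_of_mainConjectureContra` (Sprung 2024 §5.2 in print keying via the `ι`-twist
dictionary), fed with conjuncts 1, 2, 3, 5, 6, 7 of `PublishedInputsX8Contra`. Unconditional as an implication; closes this item only.
[cite: Sprung2024, Thm. 5.3 (p. 38) and §5.2 Lemmas 5.5–5.9 (pp. 39–41)] [cite: Sprung2012, Main Conj. 7.21 (p. 1505) and §7.5]
[cite: GreenbergLNM1716, §1 (p. 60)] [cite: Miller2011LMS, Def. 1.1] -/
theorem rankZeroLinkOfPrintX8Contra_holds : RankZeroLinkOfPrintX8Contra := by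
  intro hPub hGZK hMC
  obtain ⟨hmodf, h22, h714, -, h59, h3, hmod⟩ := hPub
  unfold RankEqAnalyticRankLeOne at hGZK
  exact X8MainConjectureRoadContra.missingPPartAt_rankZero_of_mainConjectureContra hmodf h22 h714 h59 h3 hGZK hmod hMC

end Summit.BirchSwinnertonDyer.BirchSwinnertonDyer.Theorems.PrintX8VSCGlue
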